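import Summits.CriticalPhenomena.PercolationContinuityZ3.Theorems.PercNearOneGluingAdditiveGluingSandwichCoreS
import HarnessLib

/-!
# A sandwich extension of the van den Berg–Häggström–Kahn inequality — III: Corollary H and
# Kozma–Nitzan's Lemma 3 for every observer-cluster event (the kernel C1)

Crux `PercNearOneGluing.AdditiveGluing` (stmt-CriticalPhenomena-4576), line
`subuniform-dead-pocket-maximum`, stub `stub_goodStep` (siege seat k41); lands with
`--supports stmt-CriticalPhenomena-4576`, registered stub `stub_sandwichLemma3_k41`.
No new definitions, no named facts.  Parts I–II: `…SandwichLemmaU.lean`, `…SandwichCoreS.lean`.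

* `sandwich_condAssoc` (**Corollary H**): for vertices `s, o, t`, an increasing `F` and an
  ARBITRARY `h : Set (Sym2 V) → [0,1]`, given `D = {s ↮ t}` the cluster function `F(C_s)` and the
  sandwich function `g = 1{s↔o} + 1{s↮o} 1{o↮t} h(C_o)` are positively correlated,
  `(∫_D F)(∫_D g) ≤ μ(D) ∫_D F g` (Theorem S with `U = univ`, `X = Y = {t}`).  `h ≡ 0` and `h ≡ 1`
  are BHK 2006 Thms 1.3 and 1.4/1.5; `h` monotone is BHK with source sets; general `h` is new.
* `lemma3_sandwich` (**Corollary L3** = Kozma–Nitzan arXiv:2401.12397 Lemma 3 for EVERY event of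
  the observer's cluster in the sandwich `{a₂ ∈ C(o), a₁ ∉ C(o)} ⊆ Q ⊆ {a₁ ∉ C(o)}`): if
  `μ(a₁ ↔ b) ≤ μ(a₂ ↔ b)` then `μ(a₁ ↔ b, Q) ≤ μ(a₂ ↔ b, Q)`.  KN's 3(i)/(ii) are the two ends; the
  lead's kernel C1 of `stub_goodStep` ("Pen ≤ Y₁ − X", `Lines/…goodstep-c1.md`) is
  `Q = {a₂ ∈ C(o) ∌ a₁} ∪ {C(o) ∈ R}`, `R` any family of dead pockets.  Part IV
  (`…GoodTwoRelays.lean`) turns it into goodness of every quadruple with `|A ∖ b| ≤ 2`.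
-/

noncomputable section

open MeasureTheory unitInterval
open Literature.Probability.LatticeModels (prodBernoulli)
open Literature.Probability.Percolation
open Literature.Probability.Percolation.BHK2006

namespace Summit.CriticalPhenomena.PercolationContinuityZ3.Theorems

/-! ### Corollary H: conditional sandwich association given `{s ↮ t}` -/

open scoped Classical in
open SandwichK41 DecisionTree in
/-- **Corollary H (conditional sandwich association).**  Let `s, o, t` be vertices, `F` increasing,
and `h : Set (Sym2 V) → [0,1]` ARBITRARY.  Given `D = {s ↮ t}`, the increasing cluster function
`F(C_s)` and the sandwich function `g = 1{s ↔ o} + 1{s ↮ o} 1{o ↮ t} h(C_o)` (which is `1` when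
the observer `o` lies in `C_s`, `0` when it lies in `C_t`, and an arbitrary `[0,1]`-valued function
of `C_o` otherwise) are positively correlated, in denominator-free form
`(∫_D F(C_s) dμ)(∫_D g dμ) ≤ μ(D) ∫_D F(C_s) g dμ`, `μ = prodBernoulli w`.
`h ≡ 0` is BHK 2006 Thm 1.3 for `(F(C_s), 1{s ↔ o})`, `h ≡ 1` is BHK Thm 1.4/1.5 for
`(F(C_s), 1{o ↔ t})`; general `h` is Theorem S (`SandwichK41.coreS`) with `U = univ`,
`X = Y = {t}`, `F` shifted by `F ∅`. [cite: VandenbergHaggstromKahn2005, Thms. 1.1–1.5 (pp. 3–8)] -/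
theorem sandwich_condAssoc {V : Type*} [Fintype V] (w : Sym2 V → unitInterval) (s o t : V)
    (F : Set (Sym2 V) → ℝ) (hF : Monotone F) (h : Set (Sym2 V) → ℝ) (h0 : ∀ C, 0 ≤ h C)
    (h1 : ∀ C, h C ≤ 1) :
    (∫ ω in {ω : BondConfig V | ¬ (openGraph ω).Reachable s t},
        F (openEdgeCluster ω s) ∂(prodBernoulli w)) *
      (∫ ω in {ω : BondConfig V | ¬ (openGraph ω).Reachable s t},
        (if (openGraph ω).Reachable s o then (1 : ℝ)
          else if (openGraph ω).Reachable o t then 0 else h (openEdgeCluster ω o))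
          ∂(prodBernoulli w)) ≤
    (prodBernoulli w).real {ω : BondConfig V | ¬ (openGraph ω).Reachable s t} *
      ∫ ω in {ω : BondConfig V | ¬ (openGraph ω).Reachable s t},
        F (openEdgeCluster ω s) *
          (if (openGraph ω).Reachable s o then (1 : ℝ)
            else if (openGraph ω).Reachable o t then 0 else h (openEdgeCluster ω o))
          ∂(prodBernoulli w) := by
  classical
  set D : Set (BondConfig V) := {ω | ¬ (openGraph ω).Reachable s t} with hD
  set gg : BondConfig V → ℝ := fun ω => if (openGraph ω).Reachable s o then (1 : ℝ)
    else if (openGraph ω).Reachable o t then 0 else h (openEdgeCluster ω o) with hgg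
  show (∫ ω in D, F (openEdgeCluster ω s) ∂(prodBernoulli w)) * (∫ ω in D, gg ω ∂(prodBernoulli w)) ≤
    (prodBernoulli w).real D * ∫ ω in D, F (openEdgeCluster ω s) * gg ω ∂(prodBernoulli w)
  have hDm : MeasurableSet D := MeasurableSet.of_discrete
  set w' : Sym2 V → ℝ := fun e => (w e : ℝ) with hw'
  have hw0 : ∀ e, 0 ≤ w' e := fun e => (w e).2.1
  have hw1 : ∀ e, w' e ≤ 1 := fun e => (w e).2.2
  -- the integrals as finite sums
  have hint : ∀ k : Set (Sym2 V) → ℝ,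
      ∫ ω in D, k ω ∂(prodBernoulli w) = ∑ ω, weight w' ω * (k ω * ind D ω) := by
    intro k
    rw [← integral_indicator hDm, integral_prodBernoulli_eq_sum]
    refine Finset.sum_congr rfl fun ω _ => ?_
    by_cases hω : ω ∈ D
    · rw [Set.indicator_of_mem hω, ind_of_mem hω, mul_one]
    · rw [Set.indicator_of_notMem hω, ind_of_not_mem hω]; ring
  have hreal : (prodBernoulli w).real D = ∑ ω, weight w' ω * ind D ω := by
    rw [← integral_indicator_one hDm, integral_prodBernoulli_eq_sum]
    refine Finset.sum_congr rfl fun ω _ => ?_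
    by_cases hω : ω ∈ D
    · rw [Set.indicator_of_mem hω, ind_of_mem hω, Pi.one_apply]
    · rw [Set.indicator_of_notMem hω, ind_of_not_mem hω, mul_zero]
  have hm : ∑ ω, weight w' ω = 1 := by
    have e := integral_prodBernoulli_eq_sum w fun _ => (1 : ℝ)
    simp only [integral_const, probReal_univ, smul_eq_mul, mul_one] at e
    exact e.symm
  -- `U = univ`: the restricted quantities are the original ones
  have hE : ∀ ω : Set (Sym2 V), ω ∩ edgesIn (Finset.univ : Finset V) = ω := fun ω => by
    ext e
    simp only [Set.mem_inter_iff, edgesIn, Set.mem_setOf_eq, Finset.mem_univ, imp_true_iff,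
      and_true]
  have hC : ∀ (v : V) ω, rC Finset.univ v ω = openEdgeCluster ω v := fun v ω => by
    simp only [rC, hE]
  have hDD : rD Finset.univ s ({t} : Set V) = D := by
    ext ω
    simp only [rD, hE, hD, Set.mem_setOf_eq, Set.mem_singleton_iff, forall_eq]
  set g : V → Finset V → Set V → Set (Sym2 V) → ℝ := fun s' U T ω =>
    if (openGraph (ω ∩ edgesIn U)).Reachable s' o then (1 : ℝ) else h (rC U o ω) * ind (rD U o T) ω
    with hgdef
  have hgt : ∀ ω, g s Finset.univ ({t} : Set V) ω = gg ω := by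
    intro ω
    simp only [hgdef, hgg, hC, hE]
    by_cases hso : (openGraph ω).Reachable s o
    · rw [if_pos hso, if_pos hso]
    · rw [if_neg hso, if_neg hso]
      by_cases hot : (openGraph ω).Reachable o t
      · rw [if_pos hot, ind_of_not_mem]
        · ring
        · intro hω
          exact hω t rfl (by simpa only [hE] using hot)
      · rw [if_neg hot, ind_of_mem, mul_one]
        intro x hx
        rw [Set.mem_singleton_iff] at hx
        subst hx
        simpa only [hE] using hot
  -- Theorem S with `X = Y = {t}` for the shifted (nonnegative) `F`
  have hXU : ({t} : Set V) ⊆ ↑(Finset.univ : Finset V) := by simp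
  have key := coreS w' hw0 hw1 hm o h h0 h1 g (fun _ _ _ _ => rfl) Finset.univ s (Finset.mem_univ s)
    (Finset.mem_univ o) {t} {t} hXU hXU (fun a => F a - F ∅)
    (fun a b hab => sub_le_sub_right (hF hab) _) (fun a => sub_nonneg.2 (hF (Set.empty_subset a)))
  rw [Set.inter_self, Set.union_self] at key
  simp only [hC, hDD, hgt] at key
  -- expand the shifted sums
  set P := ∑ ω, weight w' ω * ind D ω with hP
  set Ef := ∑ ω, weight w' ω * (F (openEdgeCluster ω s) * ind D ω) with hEf
  set Eg := ∑ ω, weight w' ω * (gg ω * ind D ω) with hEg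
  set Efg := ∑ ω, weight w' ω * (F (openEdgeCluster ω s) * gg ω * ind D ω) with hEfg
  have x1 : ∑ ω, weight w' ω * ((F (openEdgeCluster ω s) - F ∅) * ind D ω) = Ef - F ∅ * P := by
    have := sum_affine w' (fun ω => (F (openEdgeCluster ω s) - F ∅) * ind D ω)
      (fun ω => F (openEdgeCluster ω s) * ind D ω) (ind D) (ind D) (ind D) 1 (-F ∅) 0 0
      (fun ω => by ring)
    rw [this]; ring
  have x3 : ∑ ω, weight w' ω * ((F (openEdgeCluster ω s) - F ∅) * gg ω * ind D ω) =
      Efg - F ∅ * Eg := by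
    have := sum_affine w' (fun ω => (F (openEdgeCluster ω s) - F ∅) * gg ω * ind D ω)
      (fun ω => F (openEdgeCluster ω s) * gg ω * ind D ω) (fun ω => gg ω * ind D ω) (ind D) (ind D)
      1 (-F ∅) 0 0 (fun ω => by ring)
    rw [this]; ring
  rw [x1, x3] at key
  -- conclude
  rw [hint, hint, hint (fun ω => F (openEdgeCluster ω s) * gg ω), hreal]
  show Ef * Eg ≤ P * Efg
  nlinarith [key]

/-! ### Corollary L3: Kozma–Nitzan's Lemma 3 for every sandwich event of the observer's cluster -/

section Lemma3

variable {V : Type*} [Fintype V]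

/-- On `{a₁ ↔ a₂}` the events `{a₁ ↔ b}` and `{a₂ ↔ b}` coincide: for any event `E`,
`μ(E ∩ {a₁↔b}) − μ(E ∩ {a₂↔b}) = μ(E ∩ {a₁↔b} ∩ {a₁↮a₂}) − μ(E ∩ {a₂↔b} ∩ {a₁↮a₂})`. [folklore] -/
theorem real_inter_openConn_sub_eq (μ : Measure (BondConfig V)) [IsFiniteMeasure μ] (a₁ a₂ b : V)
    (E : Set (BondConfig V)) :
    μ.real (E ∩ openConn a₁ b) - μ.real (E ∩ openConn a₂ b) =
      μ.real (E ∩ openConn a₁ b ∩ (openConn a₁ a₂)ᶜ) -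
        μ.real (E ∩ openConn a₂ b ∩ (openConn a₁ a₂)ᶜ) := by
  have hms : ∀ s : Set (BondConfig V), MeasurableSet s := fun s => (Set.toFinite s).measurableSet
  have e1 := measureReal_inter_add_sdiff (μ := μ) (s := E ∩ openConn a₁ b) (hms (openConn a₁ a₂))
  have e2 := measureReal_inter_add_sdiff (μ := μ) (s := E ∩ openConn a₂ b) (hms (openConn a₁ a₂))
  have e3 : E ∩ openConn a₁ b ∩ openConn a₁ a₂ = E ∩ openConn a₂ b ∩ openConn a₁ a₂ := by
    ext ω
    simp only [Set.mem_inter_iff]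
    constructor
    · rintro ⟨⟨hE, h1b⟩, h12⟩
      exact ⟨⟨hE, (show (openGraph ω).Reachable a₁ a₂ from h12).symm.trans h1b⟩, h12⟩
    · rintro ⟨⟨hE, h2b⟩, h12⟩
      exact ⟨⟨hE, (show (openGraph ω).Reachable a₁ a₂ from h12).trans h2b⟩, h12⟩
  rw [Set.sdiff_eq] at e1 e2
  rw [e3] at e1
  linarith

open scoped Classical in
/-- **Corollary L3 (Kozma–Nitzan arXiv:2401.12397 Lemma 3, for every observer-cluster event).**
Let `a₁, a₂, b, o` be vertices with `μ(a₁ ↔ b) ≤ μ(a₂ ↔ b)` and let `Q = {C(o) ∈ 𝓕}` for a family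
`𝓕` of vertex sets that contains every value of `C(o)` containing `a₂` but not `a₁` and contains
no value of `C(o)` containing `a₁` (a "sandwich" event: `{a₂ ∈ C(o), a₁ ∉ C(o)} ⊆ Q ⊆ {a₁ ∉ C(o)}`).
Then `μ({a₁ ↔ b} ∩ Q) ≤ μ({a₂ ↔ b} ∩ Q)`.  KN's Lemma 3(i) is the bottom of the sandwich
(`Q = {o ↔ a₂} ∖ {o ↔ a₁}` up to the common part), Lemma 3(ii) its top (`Q = {o ↮ a₁}`); the lead's
kernel C1 of `stub_goodStep` is `Q = {a₂ ∈ C(o) ∌ a₁} ∪ {C(o) ∈ R}` for a family `R` of dead pockets.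
Proof: Corollary H twice on `D = {a₁ ↮ a₂}` — for `(s,t) = (a₂,a₁)` with `h = 1_𝓕` the sandwich
function is `1_Q`, giving `μ(D,a₂↔b) μ(D,Q) ≤ μ(D) μ(D,Q,a₂↔b)`; for `(s,t) = (a₁,a₂)` with
`h = 1 − 1_𝓕` it is `1 − 1_Q`, giving `μ(D) μ(D,Q,a₁↔b) ≤ μ(D,a₁↔b) μ(D,Q)`; chain them through
`μ(D,a₁↔b) ≤ μ(D,a₂↔b)`, and add the common part on `{a₁ ↔ a₂}`.
[cite: KozmaNitzan2024, Lemma 3 (pp. 6–7); VandenbergHaggstromKahn2005, Thms. 1.3–1.5] -/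
theorem lemma3_sandwich (w : Sym2 V → unitInterval) (a₁ a₂ b o : V) (𝓕 : Set (Set V))
    (hlo : ∀ ω : BondConfig V, a₂ ∈ openCluster ω o → a₁ ∉ openCluster ω o → openCluster ω o ∈ 𝓕)
    (hhi : ∀ ω : BondConfig V, openCluster ω o ∈ 𝓕 → a₁ ∉ openCluster ω o)
    (hτ : (prodBernoulli w).real (openConn a₁ b) ≤ (prodBernoulli w).real (openConn a₂ b)) :
    (prodBernoulli w).real (openConn a₁ b ∩ {ω | openCluster ω o ∈ 𝓕}) ≤
      (prodBernoulli w).real (openConn a₂ b ∩ {ω | openCluster ω o ∈ 𝓕}) := by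
  set μ := prodBernoulli w with hμ
  set Q : Set (BondConfig V) := {ω | openCluster ω o ∈ 𝓕} with hQ
  set D : Set (BondConfig V) := (openConn a₁ a₂)ᶜ with hD
  have hms : ∀ s : Set (BondConfig V), MeasurableSet s := fun s => (Set.toFinite s).measurableSet
  -- the vertex set of the observer's cluster, read off the edge cluster
  have hK : ∀ ω : BondConfig V, {v | v = o ∨ ∃ e ∈ openEdgeCluster ω o, v ∈ e} = openCluster ω o :=
    fun ω => Set.ext fun v => (reachable_iff_exists_mem_openEdgeCluster ω o v).symm
  set h : Set (Sym2 V) → ℝ := fun C => if {v | v = o ∨ ∃ e ∈ C, v ∈ e} ∈ 𝓕 then 1 else 0 with hh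
  have h0 : ∀ C, 0 ≤ h C := fun C => by simp only [hh]; split_ifs <;> norm_num
  have h1 : ∀ C, h C ≤ 1 := fun C => by simp only [hh]; split_ifs <;> norm_num
  have hhQ : ∀ ω, h (openEdgeCluster ω o) = Q.indicator 1 ω := fun ω => by
    simp only [hh, hK]
    by_cases hω : ω ∈ Q
    · rw [Set.indicator_of_mem hω, Pi.one_apply, if_pos (show openCluster ω o ∈ 𝓕 from hω)]
    · rw [Set.indicator_of_notMem hω, if_neg (show openCluster ω o ∉ 𝓕 from hω)]
  -- pointwise identification of the two sandwich functions on `D`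
  have hg2 : ∀ ω ∈ ({ω : BondConfig V | ¬ (openGraph ω).Reachable a₂ a₁}),
      (if (openGraph ω).Reachable a₂ o then (1 : ℝ)
        else if (openGraph ω).Reachable o a₁ then 0 else h (openEdgeCluster ω o)) =
        Q.indicator 1 ω := by
    intro ω hω
    by_cases h2o : (openGraph ω).Reachable a₂ o
    · have hmem : ω ∈ Q := hlo ω h2o.symm (fun h1o => hω (h2o.trans
        (show (openGraph ω).Reachable o a₁ from h1o)))
      rw [if_pos h2o, Set.indicator_of_mem hmem, Pi.one_apply]
    · rw [if_neg h2o]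
      by_cases ho1 : (openGraph ω).Reachable o a₁
      · have hnm : ω ∉ Q := fun hq => hhi ω hq ho1
        rw [if_pos ho1, Set.indicator_of_notMem hnm]
      · rw [if_neg ho1, hhQ]
  have hg1 : ∀ ω ∈ ({ω : BondConfig V | ¬ (openGraph ω).Reachable a₁ a₂}),
      (if (openGraph ω).Reachable a₁ o then (1 : ℝ)
        else if (openGraph ω).Reachable o a₂ then 0 else (1 - h (openEdgeCluster ω o))) =
        1 - Q.indicator 1 ω := by
    intro ω hω
    by_cases h1o : (openGraph ω).Reachable a₁ o
    · have hnm : ω ∉ Q := fun hq => hhi ω hq h1o.symm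
      rw [if_pos h1o, Set.indicator_of_notMem hnm]; ring
    · rw [if_neg h1o]
      by_cases ho2 : (openGraph ω).Reachable o a₂
      · have hmem : ω ∈ Q := hlo ω ho2 (fun h' => h1o
          (show (openGraph ω).Reachable o a₁ from h').symm)
        rw [if_pos ho2, Set.indicator_of_mem hmem, Pi.one_apply]; ring
      · rw [if_neg ho2, hhQ]
  -- the two `D`'s
  have hD2 : {ω : BondConfig V | ¬ (openGraph ω).Reachable a₂ a₁} = D := by
    ext ω
    simp only [hD, Set.mem_setOf_eq, Set.mem_compl_iff]
    exact ⟨fun h' h'' => h' (show (openGraph ω).Reachable a₁ a₂ from h'').symm,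
      fun h' h'' => h' (show ω ∈ openConn a₁ a₂ from h''.symm)⟩
  have hD1 : {ω : BondConfig V | ¬ (openGraph ω).Reachable a₁ a₂} = D := rfl
  -- integrals as measures
  have hInd : ∀ S T : Set (BondConfig V),
      ∫ ω in S, T.indicator (1 : BondConfig V → ℝ) ω ∂μ = μ.real (S ∩ T) := by
    intro S T
    rw [← integral_indicator (hms S), Set.indicator_indicator, integral_indicator_one (hms _)]
  have hF : ∀ (a : V) (S : Set (BondConfig V)),
      ∫ ω in S, connIndicatorFn a b (openEdgeCluster ω a) ∂μ = μ.real (S ∩ openConn a b) := by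
    intro a S
    simp_rw [connIndicatorFn_openEdgeCluster]
    exact hInd S _
  have hmul : ∀ (S T : Set (BondConfig V)) (ω : BondConfig V),
      S.indicator (1 : BondConfig V → ℝ) ω * T.indicator 1 ω = (S ∩ T).indicator 1 ω := by
    intro S T ω
    rw [Set.inter_indicator_one, Pi.mul_apply]
  -- Corollary H for `(s, t) = (a₂, a₁)`, `h = 1_𝓕`
  have hI := sandwich_condAssoc w a₂ o a₁ (connIndicatorFn a₂ b) (monotone_connIndicatorFn a₂ b)
    h h0 h1
  rw [setIntegral_congr_fun (hms _) hg2] at hI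
  have hI' : ∫ ω in {ω : BondConfig V | ¬ (openGraph ω).Reachable a₂ a₁},
      connIndicatorFn a₂ b (openEdgeCluster ω a₂) *
        (if (openGraph ω).Reachable a₂ o then (1 : ℝ)
          else if (openGraph ω).Reachable o a₁ then 0 else h (openEdgeCluster ω o)) ∂μ =
      μ.real (D ∩ (openConn a₂ b ∩ Q)) := by
    rw [setIntegral_congr_fun (hms _) (fun ω hω => by rw [hg2 ω hω])]
    simp_rw [connIndicatorFn_openEdgeCluster, hmul]
    rw [hInd, hD2]
  rw [hI', hF, hInd, hD2] at hI
  -- Corollary H for `(s, t) = (a₁, a₂)`, `h' = 1 - 1_𝓕`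
  have hJ := sandwich_condAssoc w a₁ o a₂ (connIndicatorFn a₁ b) (monotone_connIndicatorFn a₁ b)
    (fun C => 1 - h C) (fun C => sub_nonneg.2 (h1 C)) (fun C => by linarith [h0 C])
  rw [setIntegral_congr_fun (hms _) hg1] at hJ
  have hJ' : ∫ ω in {ω : BondConfig V | ¬ (openGraph ω).Reachable a₁ a₂},
      connIndicatorFn a₁ b (openEdgeCluster ω a₁) *
        (if (openGraph ω).Reachable a₁ o then (1 : ℝ)
          else if (openGraph ω).Reachable o a₂ then 0 else (1 - h (openEdgeCluster ω o))) ∂μ =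
      μ.real (D ∩ openConn a₁ b) - μ.real (D ∩ (openConn a₁ b ∩ Q)) := by
    rw [setIntegral_congr_fun (hms _) (fun ω hω => by rw [hg1 ω hω])]
    simp_rw [mul_sub, mul_one, connIndicatorFn_openEdgeCluster, hmul]
    rw [integral_sub Integrable.of_finite Integrable.of_finite, hInd, hInd, hD1]
  have hJ'' : ∫ ω in {ω : BondConfig V | ¬ (openGraph ω).Reachable a₁ a₂},
      (1 - Q.indicator 1 ω) ∂μ = μ.real D - μ.real (D ∩ Q) := by
    rw [integral_sub Integrable.of_finite Integrable.of_finite, hInd, hD1]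
    have : ∫ ω in D, (1 : ℝ) ∂μ = μ.real D := by rw [setIntegral_const, smul_eq_mul, mul_one]
    rw [this]
  rw [hJ', hJ'', hF, hD1] at hJ
  -- the relay hypothesis on `D`, and the common part on `Dᶜ`
  have hτ' : μ.real (D ∩ openConn a₁ b) ≤ μ.real (D ∩ openConn a₂ b) := by
    have e := real_inter_openConn_sub_eq μ a₁ a₂ b Set.univ
    simp only [Set.univ_inter] at e
    rw [Set.inter_comm D, Set.inter_comm D, hD]
    linarith
  have hfin : μ.real (openConn a₁ b ∩ Q) - μ.real (openConn a₂ b ∩ Q) =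
      μ.real (D ∩ (openConn a₁ b ∩ Q)) - μ.real (D ∩ (openConn a₂ b ∩ Q)) := by
    have e := real_inter_openConn_sub_eq μ a₁ a₂ b Q
    have s1 : Q ∩ openConn a₁ b = openConn a₁ b ∩ Q := Set.inter_comm _ _
    have s2 : Q ∩ openConn a₂ b = openConn a₂ b ∩ Q := Set.inter_comm _ _
    have s3 : Q ∩ openConn a₁ b ∩ (openConn a₁ a₂)ᶜ = D ∩ (openConn a₁ b ∩ Q) := by
      ext ω; simp only [hD, Set.mem_inter_iff, Set.mem_compl_iff]; tauto
    have s4 : Q ∩ openConn a₂ b ∩ (openConn a₁ a₂)ᶜ = D ∩ (openConn a₂ b ∩ Q) := by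
      ext ω; simp only [hD, Set.mem_inter_iff, Set.mem_compl_iff]; tauto
    rw [s3, s4, s1, s2] at e
    exact e
  -- chain
  have hDn : 0 ≤ μ.real D := measureReal_nonneg
  have hkey : μ.real D * μ.real (D ∩ (openConn a₁ b ∩ Q)) ≤
      μ.real D * μ.real (D ∩ (openConn a₂ b ∩ Q)) := by
    have hQn : 0 ≤ μ.real (D ∩ Q) := measureReal_nonneg
    nlinarith [hI, hJ, hτ', mul_le_mul_of_nonneg_right hτ' hQn]
  by_cases hD0 : μ.real D = 0
  · have h1' : μ.real (D ∩ (openConn a₁ b ∩ Q)) = 0 :=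
      le_antisymm ((measureReal_mono Set.inter_subset_left).trans hD0.le) measureReal_nonneg
    have h2' : 0 ≤ μ.real (D ∩ (openConn a₂ b ∩ Q)) := measureReal_nonneg
    linarith
  · have hDp : 0 < μ.real D := lt_of_le_of_ne hDn (Ne.symm hD0)
    have := le_of_mul_le_mul_left hkey hDp
    linarith

end Lemma3

/-! ### Registered stub form (siege k41) -/

/-- **Registered stub `stub_sandwichLemma3_k41`** (= `lemma3_sandwich` on `Fin n`): Kozma–Nitzan's
Lemma 3 for every sandwich event of the observer's cluster — the kernel C1 of `stub_goodStep`.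
[cite: KozmaNitzan2024, Lemma 3 (pp. 6–7)] -/
theorem stub_sandwichLemma3_k41 : ∀ (n : ℕ) (w : Sym2 (Fin n) → unitInterval) (a₁ a₂ b o : Fin n) (𝓕 : Set (Set (Fin n))), (∀ ω : BondConfig (Fin n), a₂ ∈ openCluster ω o → a₁ ∉ openCluster ω o → openCluster ω o ∈ 𝓕) → (∀ ω : BondConfig (Fin n), openCluster ω o ∈ 𝓕 → a₁ ∉ openCluster ω o) → (prodBernoulli w).real (openConn a₁ b) ≤ (prodBernoulli w).real (openConn a₂ b) → (prodBernoulli w).real (openConn a₁ b ∩ {ω | openCluster ω o ∈ 𝓕}) ≤ (prodBernoulli w).real (openConn a₂ b ∩ {ω | openCluster ω o ∈ 𝓕}) :=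
  fun _ w a₁ a₂ b o 𝓕 hlo hhi hτ => lemma3_sandwich w a₁ a₂ b o 𝓕 hlo hhi hτ

end Summit.CriticalPhenomena.PercolationContinuityZ3.Theorems
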